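import Summits.QuantumFields.BalabanUV.Beta.FP.MarginalUniquenessWardMinimal

/-!
# `BalabanUV.Beta.FP.MarginalUniquenessWardIff` — road «FP» for binder row D1, leaf H2-G (vertex germ): THE EXACT SOLUTION SET OF
# «hyperoctahedral invariance + Ward» — `PermInvariant L ∧ FlipInvariant L ∧ WardGerm L (quadGerm 1 0 0) ↔ ∃ t, L = ymGerm + t·x`;
# the 1 ↔ 2 Bose exchange is IDLE on this set, reflections are NOT (a permutation-invariant Ward solution off the line).

HONEST DEPENDENCY (page 1, mandatory): continuum YM on T⁴ ⇐ BetaPertH ∧ nine spine estimates (0/9 proved); BetaPertH ⇐ (D1) ∧ (D4) ∧ CAP+tail;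
G-an2-4 gates asym, D1 and NE2/3/4.  HONEST FRAMING (cell contract, verbatim): «discharging `BetaPertH` makes Bałaban's UV stability UNCONDITIONAL —
a real constructive-QFT result; it is NOT the continuum limit and NOT the Clay problem.»  THIS MODULE DISCHARGES NOTHING of the wall: finite-dimensional
linear algebra over `ℝ` on the coefficient tables of `FP/MarginalUniqueness` ∕ `FP/WardNormalisation` ∕ `FP/MarginalUniquenessWardMinimal`; nothing cited,
0 sorry; NOT D1, NOT BetaPertH, NOT continuum, NOT Clay.
ABSOLUTE RULE (cell charter, verbatim): «No internally-minted statement may enter as a cited fact. Every hypothesis is either kernel-proved in this package or a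
verbatim quotation of a PUBLISHED theorem with page reference. The manuscript(s) under audit are NOT citable for their own disputed steps — they are the thing
under adjudication; programme-internal (2001/route/tribunal) claims are never citable.»

ORIGIN.  INFO-1 of XREAD C-ne5leaf02-44 (t4-ne5-formalise-leaf-02-g19, exact engine rows T4a∕T4c) on `FP/MarginalUniquenessWardMinimal` p233281:
«`PermInvariant ∧ FlipInvariant ∧ Anti12 ∧ WardGerm L (quadGerm 1 0 0) ↔ ∃ t, L = ymGerm + t·x` is available — ⇐ = the landed §5 lemmas, ⇒ = a
pattern-by-pattern proof like `cubic_unique`».  KERNEL FORM HERE, with one hypothesis FEWER: `Anti12` is not needed for ⇒ (it HOLDS on the whole line,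
`anti12_ym_add_x`), so it is idle; and reflection invariance is NOT idle (§4).
* §1 [our object] `xGerm` (`x_{μνλκ} = δ_{μλ}δ_{νκ} − δ_{μκ}δ_{νλ}` on both momentum labels; `Φ_x = (B¹∧B²)·(B³∧(p+q))`) and `ymLine t := ymGerm + t·xGerm`
  (definitionally the §5 family of `MarginalUniquenessWardMinimal`); pattern values of `xGerm`.
* §2 `pattern_values_ward`: under `PermInvariant` + Ward the eight pattern coefficients are `(0, 1, a, −1 − a ∣ 0, −1, 1 + a, −a)`, `a = L 0 1 0 1 0`
  (`ward_diag0 ∕ ward_diag1 ∕ ward_sym ∕ ward_mix` of `MarginalUniquenessWardMinimal` at `cQ = 1, α = γ = 0`).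
* §3 **`eq_ymLine_of_perm_flip_ward`**: `PermInvariant L → FlipInvariant L → WardGerm L (quadGerm 1 0 0) → L = ymLine (L 0 1 0 1 0 + 2)`;
  **`perm_flip_ward_iff`**: `(PermInvariant L ∧ FlipInvariant L ∧ WardGerm L (quadGerm 1 0 0)) ↔ ∃ t, L = ymLine t`; corollaries `anti12_of_perm_flip_ward`
  (the 1 ↔ 2 exchange is IDLE), `perm_flip_anti12_ward_iff` (INFO-1 verbatim), `eq_ymGerm_of_perm_flip_ward_anti13p` (adding the `p`-clause of 1 ↔ 3 gives
  `t = 0`).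
* §4 TIGHTNESS (reflections are NOT idle): `yGerm` (`y_{μνλκ} = δ_{μν}δ_{μλ} − δ_{μν}δ_{μκ}`, antisymmetric in `(λ, κ)`, supported on ODD index patterns):
  `ymGerm + s·y` is permutation invariant and Ward for every `s`, and for `s ≠ 0` is NOT reflection invariant and NOT on the line.
READING FOR THE ROAD (bookkeeping only): lattice (hyperoctahedral) symmetry + gauge invariance of the cubic jet pin the marginal vertex up to the single
Ward-trivial direction `x`; Bose symmetry under 1 ↔ 3 removes it (`cubic_eq_of_anti13_ward`), Bose under 1 ↔ 2 does not.
Provenance: b2b-balaban-t4-ne9-formalise-leaf-03 gen 27 (prover-b2b-balaban-t4-ne9-formalise-leaf-03-g27-0), 2026-08-20.  [our object]/[folklore].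
-/

namespace Summit.QuantumFields.BalabanUV.Beta.FP.MarginalUniquenessWardIff

open Finset
open scoped BigOperators
open Summit.QuantumFields.BalabanUV.Beta.FP.MarginalUniqueness
open Summit.QuantumFields.BalabanUV.Beta.FP.WardNormalisation
open Summit.QuantumFields.BalabanUV.Beta.FP.MarginalUniquenessWardMinimal

variable {L : CubicGerm}

/-! ## §1 The Ward-trivial direction `x` and the line `ymGerm + t·x` -/

/-- [our object] The Ward-trivial, hyperoctahedrally invariant, 1 ↔ 2 antisymmetric direction `x_{μνλκ} = δ_{μλ}δ_{νκ} − δ_{μκ}δ_{νλ}` (same on both labels). -/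
def xGerm : CubicGerm := fun μ ν lam κ _ => δ μ lam * δ ν κ - δ μ κ * δ ν lam

/-- [our object] The line `ymGerm + t·x`. -/
def ymLine (t : ℝ) : CubicGerm := fun μ ν lam κ i => ymGerm μ ν lam κ i + t * xGerm μ ν lam κ i

/-- [our object] `ymLine t` is, definitionally, the §5 family of `MarginalUniquenessWardMinimal`. -/
theorem ymLine_eq (t : ℝ) : ymLine t = fun μ ν lam κ i => ymGerm μ ν lam κ i + t * (δ μ lam * δ ν κ - δ μ κ * δ ν lam) := rfl

/-- [our object] `ymLine 0 = ymGerm`. -/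
theorem ymLine_zero : ymLine 0 = ymGerm := by
  funext μ ν lam κ i; simp [ymLine]

/-- [our object] `x` vanishes when the two quantum indices coincide. -/
theorem xGerm_aa (μ lam κ : Idx) (i : Fin 2) : xGerm μ μ lam κ i = 0 := by
  simp [xGerm]; ring

/-- [our object] `x_{abab} = 1` (`a ≠ b`). -/
theorem xGerm_abab {μ ν : Idx} (h : μ ≠ ν) (i : Fin 2) : xGerm μ ν μ ν i = 1 := by
  simp [xGerm, δ_of_ne h, δ_of_ne (Ne.symm h)]

/-- [our object] `x_{abba} = −1` (`a ≠ b`). -/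
theorem xGerm_abba {μ ν : Idx} (h : μ ≠ ν) (i : Fin 2) : xGerm μ ν ν μ i = -1 := by
  simp [xGerm, δ_of_ne h, δ_of_ne (Ne.symm h)]

/-- [our object] `x_{abac} = 0` (`a ≠ b`, `b ≠ c`). -/
theorem xGerm_abac {μ ν κ : Idx} (h1 : μ ≠ ν) (h : ν ≠ κ) (i : Fin 2) : xGerm μ ν μ κ i = 0 := by
  simp [xGerm, δ_of_ne h, δ_of_ne (Ne.symm h1)]

/-- [our object] `x_{abca} = 0` (`a ≠ b`, `b ≠ c`). -/
theorem xGerm_abca {μ ν lam : Idx} (h1 : μ ≠ ν) (h : ν ≠ lam) (i : Fin 2) : xGerm μ ν lam μ i = 0 := by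
  simp [xGerm, δ_of_ne h, δ_of_ne (Ne.symm h1)]

/-- [our object] `x_{abcd} = 0` (`a ∉ {c, d}`). -/
theorem xGerm_abcd {μ ν lam κ : Idx} (h2 : μ ≠ lam) (h3 : μ ≠ κ) (i : Fin 2) : xGerm μ ν lam κ i = 0 := by
  simp [xGerm, δ_of_ne h2, δ_of_ne h3]

/-! ## §2 The eight pattern coefficients under `PermInvariant` + Ward -/

/-- [folklore] **PATTERN VALUES**: `L 0000 i = 0`, `L 0011 0 = 1`, `L 0011 1 = −1`, `L 0110 0 = −1 − a`, `L 0101 1 = 1 + a`, `L 0110 1 = −a` with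
`a := L 0101 0` — from the evaluated Ward identity (`cQ = 1`, `α = γ = 0`) alone; `PermInvariant` is not even used here. -/
theorem pattern_values_ward (hW : WardGerm L (quadGerm 1 0 0)) :
    L 0 0 0 0 0 = 0 ∧ L 0 0 0 0 1 = 0 ∧ L 0 0 1 1 0 = 1 ∧ L 0 0 1 1 1 = -1 ∧
      L 0 1 1 0 0 = -1 - L 0 1 0 1 0 ∧ L 0 1 0 1 1 = 1 + L 0 1 0 1 0 ∧ L 0 1 1 0 1 = -L 0 1 0 1 0 := by
  have h10 : (0 : Idx) ≠ 1 := by decide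
  have d1 := ward_diag0 hW 0 0 0
  have d2 := ward_diag1 hW 0 0 0
  have d3 := ward_diag0 hW 0 0 1
  have d4 := ward_diag1 hW 0 0 1
  have s1 := ward_sym hW 0 1 h10
  have m1 := ward_mix hW 0 1 0 1
  have m2 := ward_mix hW 0 1 1 0
  simp only [δ_self, δ_of_ne h10, δ_of_ne h10.symm] at d1 d2 d3 d4 s1
  refine ⟨by linarith, by linarith, by linarith, by linarith, by linarith, by linarith, by linarith⟩

/-! ## §3 The solution set of «hyperoctahedral invariance + Ward» is the line -/

/-- [folklore] **HYPEROCTAHEDRAL INVARIANCE + WARD ⟹ THE LINE**: `L = ymGerm + (L 0101 0 + 2)·x`, entry by entry (the case analysis of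
`MarginalUniqueness.cubic_unique` with the Bose equations replaced by the evaluated Ward identity). -/
theorem eq_ymLine_of_perm_flip_ward (hP : PermInvariant L) (hF : FlipInvariant L) (hW : WardGerm L (quadGerm 1 0 0)) :
    L = ymLine (L 0 1 0 1 0 + 2) := by
  obtain ⟨e00, e01, e10, e11, ec0, eb1, ec1⟩ := pattern_values_ward hW
  funext μ ν lam κ i
  have hi : i = 0 ∨ i = 1 := by fin_cases i <;> simp
  have h10 : ¬ (1 : Fin 2) = 0 := by decide
  simp only [ymLine]
  by_cases hmn : μ = ν
  · subst hmn
    rw [xGerm_aa, mul_zero, add_zero]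
    by_cases hlk : lam = κ
    · subst hlk
      by_cases hml : μ = lam
      · subst hml
        rw [val_aaaa hP μ i, ymGerm_aaaa]
        rcases hi with rfl | rfl
        · exact e00
        · exact e01
      · rw [val_aabb hP hml i, ymGerm_aabb hml]
        rcases hi with rfl | rfl
        · rw [if_pos rfl]; exact e10
        · rw [if_neg h10]; exact e11
    · by_cases hml : μ = lam
      · subst hml
        rw [eq_zero_of_flip hF κ i (by rw [rs_of_ne hlk, rs_self]; norm_num), ymGerm_aaab hlk]
      · rw [eq_zero_of_flip hF lam i (by rw [rs_of_ne hml, rs_self, rs_of_ne (Ne.symm hlk)]; norm_num),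
          ymGerm_aabc hml hlk]
  · by_cases hml : μ = lam
    · subst hml
      by_cases hnk : ν = κ
      · subst hnk
        rw [val_abab hP hmn i, ymGerm_abab hmn, xGerm_abab hmn]
        rcases hi with rfl | rfl
        · rw [if_pos rfl]; ring
        · rw [if_neg h10, eb1]; ring
      · rw [eq_zero_of_flip hF ν i (by rw [rs_of_ne hmn, rs_self, rs_of_ne (Ne.symm hnk)]; norm_num),
          ymGerm_abac hmn hnk, xGerm_abac hmn hnk]; ring
    · by_cases hmk : μ = κ
      · subst hmk
        by_cases hnl : ν = lam
        · subst hnl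
          rw [val_abba hP hmn i, ymGerm_abba hmn, xGerm_abba hmn]
          rcases hi with rfl | rfl
          · rw [if_pos rfl, ec0]; ring
          · rw [if_neg h10, ec1]; ring
        · rw [eq_zero_of_flip hF ν i (by rw [rs_of_ne hmn, rs_self, rs_of_ne (Ne.symm hnl)]; norm_num),
            ymGerm_abca hmn hnl hml, xGerm_abca hmn hnl]; ring
      · rw [eq_zero_of_flip hF μ i (by rw [rs_self, rs_of_ne (Ne.symm hmn), rs_of_ne (Ne.symm hml), rs_of_ne (Ne.symm hmk)]; norm_num),
          ymGerm_abcd hmn hml hmk, xGerm_abcd hml hmk]; ring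

/-- [folklore] **THE IFF**: hyperoctahedral invariance + Ward against the canonical transverse germ ⟺ membership in the line `ymGerm + t·x`. -/
theorem perm_flip_ward_iff (L : CubicGerm) :
    (PermInvariant L ∧ FlipInvariant L ∧ WardGerm L (quadGerm 1 0 0)) ↔ ∃ t : ℝ, L = ymLine t := by
  constructor
  · rintro ⟨hP, hF, hW⟩
    exact ⟨_, eq_ymLine_of_perm_flip_ward hP hF hW⟩
  · rintro ⟨t, rfl⟩
    exact ⟨permInvariant_ym_add_x t, flipInvariant_ym_add_x t, wardGerm_ym_add_x t⟩

/-- [folklore] **THE 1 ↔ 2 EXCHANGE IS IDLE**: hyperoctahedral invariance + Ward already imply `Anti12`. -/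
theorem anti12_of_perm_flip_ward (hP : PermInvariant L) (hF : FlipInvariant L) (hW : WardGerm L (quadGerm 1 0 0)) : Anti12 L := by
  rw [eq_ymLine_of_perm_flip_ward hP hF hW]
  exact anti12_ym_add_x _

/-- [folklore] INFO-1 of XREAD C-ne5leaf02-44 verbatim: `Perm ∧ Flip ∧ Anti12 ∧ Ward(quadGerm 1 0 0) ↔ ∃ t, L = ymGerm + t·x`. -/
theorem perm_flip_anti12_ward_iff (L : CubicGerm) :
    (PermInvariant L ∧ FlipInvariant L ∧ Anti12 L ∧ WardGerm L (quadGerm 1 0 0)) ↔ ∃ t : ℝ, L = ymLine t := by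
  rw [← perm_flip_ward_iff]
  constructor
  · rintro ⟨hP, hF, -, hW⟩; exact ⟨hP, hF, hW⟩
  · rintro ⟨hP, hF, hW⟩; exact ⟨hP, hF, anti12_of_perm_flip_ward hP hF hW, hW⟩

/-- [folklore] On the line, the `p`-clause of the 1 ↔ 3 exchange at ONE entry forces `t = 0`: `(ymLine t) 1 1 0 0 0 = (ymLine t) 0 1 1 0 0` iff `t = 0`. -/
theorem ymLine_anti13p_entry_iff (t : ℝ) : ymLine t 1 1 0 0 0 = ymLine t 0 1 1 0 0 ↔ t = 0 := by
  have h10 : (1 : Idx) ≠ 0 := by decide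
  simp only [ymLine, ymGerm_aabb h10, xGerm_aa, ymGerm_abba h10.symm, xGerm_abba h10.symm]
  constructor <;> intro h <;> simp at h ⊢ <;> linarith

/-- [folklore] … hence hyperoctahedral invariance + Ward + the `p`-clause of 1 ↔ 3 give `L = ymGerm` (a third route to the owner's headline; the
minimal route `cubic_eq_of_anti13p_ward` needs neither `PermInvariant` nor `FlipInvariant`). -/
theorem eq_ymGerm_of_perm_flip_ward_anti13p (hP : PermInvariant L) (hF : FlipInvariant L) (hW : WardGerm L (quadGerm 1 0 0))
    (h13p : ∀ μ ν lam κ : Idx, L lam ν μ κ 0 = L μ ν lam κ 0) : L = ymGerm := by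
  have hL := eq_ymLine_of_perm_flip_ward hP hF hW
  have ht : L 0 1 0 1 0 + 2 = 0 := by
    rw [← ymLine_anti13p_entry_iff, ← hL]
    exact h13p 0 1 1 0
  rw [hL, ht, ymLine_zero]

/-! ## §4 TIGHTNESS: reflection invariance is NOT idle -/

/-- [our object] The ODD-pattern direction `y_{μνλκ} = δ_{μν}δ_{μλ} − δ_{μν}δ_{μκ}` (same on both labels): permutation invariant, antisymmetric in
`(λ, κ)` (hence Ward-trivial), supported on index patterns with an axis of odd multiplicity (hence killed by reflections). -/
def yGerm : CubicGerm := fun μ ν lam κ _ => δ μ ν * δ μ lam - δ μ ν * δ μ κ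

/-- [our object] `ymGerm + s·y` is invariant under axis permutations. -/
theorem permInvariant_ym_add_y (s : ℝ) : PermInvariant (fun μ ν lam κ i => ymGerm μ ν lam κ i + s * yGerm μ ν lam κ i) := by
  intro σ μ ν lam κ i
  simp only [ymGerm, yGerm, δ_perm]

/-- [our object] `ymGerm + s·y` satisfies the Ward identity against `quadGerm 1 0 0` for every `s` (`y` is antisymmetric in the contracted slots). -/
theorem wardGerm_ym_add_y (s : ℝ) : WardGerm (fun μ ν lam κ i => ymGerm μ ν lam κ i + s * yGerm μ ν lam κ i) (quadGerm 1 0 0) := by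
  intro p q μ ν
  fin_cases μ <;> fin_cases ν <;>
    simp [Fin.sum_univ_four, ymGerm, yGerm, quadGerm, δ, nsq] <;> ring

/-- [folklore] **REFLECTIONS ARE NOT IDLE**: for `s ≠ 0`, `ymGerm + s·y` is permutation invariant and Ward, but NOT reflection invariant and NOT on the line
`ymGerm + t·x` (its entry `(0,0,0,1 ∣ p)` is `s ≠ 0`, where every member of the line vanishes). -/
theorem not_line_without_flip {s : ℝ} (hs : s ≠ 0) :
    let L : CubicGerm := fun μ ν lam κ i => ymGerm μ ν lam κ i + s * yGerm μ ν lam κ i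
    PermInvariant L ∧ WardGerm L (quadGerm 1 0 0) ∧ ¬ FlipInvariant L ∧ ∀ t : ℝ, L ≠ ymLine t := by
  have h01 : (0 : Idx) ≠ 1 := by decide
  have hv : ymGerm 0 0 0 1 0 + s * yGerm 0 0 0 1 0 = s := by
    rw [ymGerm_aaab h01]; simp [yGerm, δ_of_ne h01]
  refine ⟨permInvariant_ym_add_y s, wardGerm_ym_add_y s, ?_, ?_⟩
  · intro hF
    have h := hF 1 0 0 0 1 0
    simp only [hv, rs_self, rs_of_ne h01] at h
    exact hs (by linarith)
  · intro t h
    have h1 := congrFun (congrFun (congrFun (congrFun (congrFun h 0) 0) 0) 1) 0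
    rw [hv, ymLine, ymGerm_aaab h01, xGerm_aa] at h1
    exact hs (by simpa using h1)

end Summit.QuantumFields.BalabanUV.Beta.FP.MarginalUniquenessWardIff
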